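import Literature.MathematicalPhysics.QuantumLattice.HubbardProjectedOneParticleCost
import Literature.MathematicalPhysics.QuantumLattice.HubbardParityGapCeiling
import Literature.MathematicalPhysics.QuantumLattice.HubbardLSMFillingProofs
import HarnessLib

/-!
# A coupling-independent ceiling on the parity gap of the repulsive Hubbard torus: `PG ≤ 4 + 12/√δ`

Topic `MathematicalPhysics/QuantumLattice` (family `hubbard`); proof-only.  Part 3 of 3 (parts 1–2:
`HubbardProjectedCreationCommutator`, `HubbardProjectedOneParticleCost`), written for route
`HubbardSuperconductivity/ParityGapRigidity`: its crux `GappedWindow` (stmt-HubbardSuperconductivity-2196)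
posits `U > 0`, `δ ∈ (0, 1/2)` with an `L`-uniform one-particle parity gap
`E(N_L+1) + E(N_L-1) - 2E₀(N_L, S^z=0) ≥ 2Δ > 0` along the even tori, and its kill criterion
`NoUniformParityGap` (stmt-…-2198) denies this everywhere.  The tree's a-priori ceiling
(`HubbardParityGapCeiling.uniformParityGap_le`: `Δ ≤ 2|U|/√(1-δ)`) is linear in `U` and says nothing at
strong coupling.  Here:

**Theorem** (`parityGap_le_of_nonneg`).  For `H = hubbardTorus 2 L 1 U` with `U ≥ 0` (any `L ≥ 1`) and
the sector `(2n, S^z = 0)` with `1 ≤ n`, `2n < L²` (strictly below half filling):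
`E(2n+1) + E(2n-1) - 2E₀(2n, 0) ≤ 4 + 12·L/√(L² - 2n)`.

Proof: a unit sector ground state `ψ` is an eigenvector, so part 2 applies on the torus graph (degree
`≤ 4`, `t = 1`): adding an electron with the PROJECTED trial states `(1-n_{z↓})c†_{z↑}ψ` costs at most
`12·√(L²)/√(L² - 2n)` whatever `U` is (the projected creation commutes with the repulsion; the weight of
the trial states is the number of empty sites `≥ L² - 2n`), and removing one at the best site costs at
most `4` because for `U ≥ 0` removal never raises the repulsion.

* `parityGap_le_of_doping_nonneg` — at doping `δ ∈ (0, 1)`: for all `L ≥ L₀(δ)` (even or not),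
  `PG(N_L; L) ≤ 4 + 12/√δ`, `N_L = 2⌊(1-δ)L²/2⌋`, uniformly in `U ≥ 0`;
* `uniformParityGap_le_of_nonneg` — **every `L`-uniform parity gap of the repulsive model has
  `Δ ≤ 2 + 6/√δ`, whatever the coupling**; with the `O(U)` ceiling:
  `uniformParityGap_le_min` — `Δ ≤ min (2|U|/√(1-δ)) (2 + 6/√δ)`.

Reading (regime map for the crux and its refuters).  The window's gap is confined to
`Δ ≤ min(2U/√(1-δ), 2 + 6/√δ)`: `O(U)` at weak coupling (vanishing at the free point, where (PG) is
false, `Theorems/ParityGapRigidityZeroCouplingParityGap`) and `O(t)` — never `O(U)` — at strong coupling: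
in the doped repulsive model the upper Hubbard band is never touched by the cheapest added electron, so no
Mott-type `~U` parity gap can occur below half filling (contrast half filling, where the charge gap IS
`~U` and the bound degenerates correctly: the weight `L² - 2n` of the projected trial states vanishes).
At `δ = 0.4` (the Kohn–Luttinger candidate of the crux): `Δ ≤ 11.5` for all `U`, `Δ ≤ 2.6·U` for
`U ≤ 4.4`.  What remains open of the kill criterion is exactly `0 < Δ ≤ min(2U/√(1-δ), 2 + 6/√δ)`.

Sources: H. Tasaki, *Physics and Mathematics of Quantum Many-Body Systems* (2020) §2.1, §9.3, §11.2;
W. F. Brinkman, T. M. Rice, Phys. Rev. B 2 (1970) 4302 §II; K. A. Matveev, A. I. Larkin, PRL 78 (1997)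
3749 (parity gap); E. H. Lieb, PRL 62 (1989) 1201 (the `S^z = 0` sector).  Folklore finite-dimensional
statements; no definitions, no named facts.

## Mathlib / tree search

Tree (REUSED): `groundEnergy_succ_le_projected`, `groundEnergy_pred_le_of_nonneg` (part 2),
`card_filter_fermionTorusGraph_adj_le` (`HubbardLSMFillingProofs`), `szSector_groundState`,
`exists_smul_unit`, `mem_szSector_iff`, `uniformParityGap_le` (`HubbardParityGapCeiling`).
Mathlib: `Real.sqrt_sq`, `Real.sqrt_le_sqrt`, `div_le_div_of_nonneg_left`, `exists_nat_gt`, `Nat.floor_le`.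
-/

noncomputable section

namespace Literature.MathematicalPhysics.QuantumLattice

open Matrix Finset HubbardWave0 ThermodynamicLimit Literature.Probability.LatticeModels
open scoped ComplexOrder ComplexConjugate Matrix.Norms.L2Operator InnerProductSpace

section Ceiling

variable {L : ℕ} [NeZero L]

/-- Every site of the two-dimensional fermionic torus has at most `4` neighbours
(`card_filter_fermionTorusGraph_adj_le` with `d = 2`, in the `#{y | x ∼ y}` format of the one-particle
cost lemmas). [folklore] -/
theorem card_filter_fermionTorusGraph_two_adj_le_four (x : FermionTorus 2 L) :
    #{y | (fermionTorusGraph 2 L).Adj x y} ≤ 4 :=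
  (card_filter_fermionTorusGraph_adj_le (d := 2) x).trans (by norm_num)

/-- **Coupling-independent ceiling on the parity gap of the repulsive Hubbard torus.**  For
`H = hubbardTorus 2 L 1 U` with `U ≥ 0` and the sector `(2n, S^z = 0)`, `1 ≤ n`, `2n < L²`:
`E(2n+1) + E(2n-1) - 2E₀(2n, S^z=0) ≤ 4 + 12·L/√(L² - 2n)`.
Proof: a unit ground state `ψ` of the sector is an eigenvector of `H` with `2n` electrons; by
`groundEnergy_succ_le_projected` (projected trial states `(1-n_{z↓})c†_{z↑}ψ`, degree `4`, `t = 1`, ANY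
`U`) `E(2n+1) ≤ E₀ + 12√(L²)/√(L² - 2n)`, and by `groundEnergy_pred_le_of_nonneg` (`U ≥ 0`: removal never
raises the repulsion) `E(2n-1) ≤ E₀ + 4`.  No property of the ground state beyond the eigenvalue equation
is used. Tasaki (2020) §2.1, §11.2; Brinkman–Rice (1970) §II. [folklore] -/
theorem parityGap_le_of_nonneg {U : ℝ} (hU : 0 ≤ U) {n : ℕ} (hn1 : 1 ≤ n) (hn : 2 * n < L ^ 2) :
    groundEnergy (hubbardTorus 2 L 1 U) (2 * n + 1) + groundEnergy (hubbardTorus 2 L 1 U) (2 * n - 1) -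
        2 * (hubbardTorus 2 L 1 U).minEnergyOn (szSector (Λ := FermionTorus 2 L) (2 * n) 0) ≤
      4 + 12 * L / Real.sqrt ((L : ℝ) ^ 2 - 2 * n) := by
  classical
  set H := hubbardTorus 2 L 1 U with hH
  set E : ℝ := H.minEnergyOn (szSector (Λ := FermionTorus 2 L) (2 * n) 0) with hEdef
  have hcardF : Fintype.card (FermionTorus 2 L) = L ^ 2 := by simp [FermionTorus, Fintype.card_fin]
  -- a unit ground state of the sector
  have hnL : n ≤ Fintype.card (FermionTorus 2 L) := by rw [hcardF]; omega
  obtain ⟨⟨ψ₀, hψ₀mem, hψ₀0, hψ₀E⟩, -⟩ := szSector_groundState (fermionTorusGraph 2 L) 1 U hnL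
  obtain ⟨c, -, hc1⟩ := exists_smul_unit hψ₀0
  set ψ := c • ψ₀ with hψdef
  have hψmem : ψ ∈ szSector (Λ := FermionTorus 2 L) (2 * n) 0 := Submodule.smul_mem _ c hψ₀mem
  have hψ₀E' : H *ᵥ ψ₀ = (E : ℂ) • ψ₀ := hψ₀E
  have hψE : hamiltonian (fermionTorusGraph 2 L) 1 U *ᵥ ψ = (E : ℂ) • ψ := by
    show H *ᵥ ψ = (E : ℂ) • ψ
    rw [hψdef, mulVec_smul, hψ₀E', smul_comm]
  have hNP : IsNParticle (2 * n) ψ := ((mem_szSector_iff _ _ _).1 hψmem).1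
  -- the two one-particle costs
  have hlt : 2 * n < Fintype.card (FermionTorus 2 L) := by rwa [hcardF]
  have hadd : groundEnergy H (2 * n + 1) ≤
      E + 3 * (4 : ℕ) * |(1 : ℝ)| * Real.sqrt (Fintype.card (FermionTorus 2 L)) /
        Real.sqrt (Fintype.card (FermionTorus 2 L) - (2 * n : ℕ)) :=
    groundEnergy_succ_le_projected (fermionTorusGraph 2 L) card_filter_fermionTorusGraph_two_adj_le_four
      1 U hNP hc1 hψE hlt
  have hrem : groundEnergy H (2 * n - 1) ≤ E + (4 : ℕ) * |(1 : ℝ)| :=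
    groundEnergy_pred_le_of_nonneg (fermionTorusGraph 2 L) card_filter_fermionTorusGraph_two_adj_le_four
      1 hU hNP hc1 hψE (by omega)
  rw [hcardF, abs_one, mul_one] at hadd
  rw [abs_one, mul_one] at hrem
  push_cast at hadd hrem
  rw [Real.sqrt_sq (Nat.cast_nonneg L)] at hadd
  rw [mul_div_assoc] at hadd ⊢
  have : (3 * 4 : ℝ) * (L / Real.sqrt ((L : ℝ) ^ 2 - 2 * n)) = 12 * (L / Real.sqrt ((L : ℝ) ^ 2 - 2 * n)) := by
    norm_num
  linarith

omit [NeZero L] in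
/-- **The coupling-independent parity-gap ceiling at fixed doping.**  For every `U ≥ 0` and `0 < δ < 1`
there is `L₀` (depending on `δ` only) such that for ALL `L ≥ L₀` the Hubbard torus `hubbardTorus 2 L 1 U`
at `N_L = 2⌊(1-δ)L²/2⌋` electrons obeys
`E(N_L+1) + E(N_L-1) - 2E₀(N_L, S^z = 0) ≤ 4 + 12/√δ`
(`parityGap_le_of_nonneg` with `L² - N_L ≥ δL²`).  So at strong coupling the parity gap of the doped
repulsive model stays `O(t)`: it is never of Mott size `~U`. [folklore] -/
theorem parityGap_le_of_doping_nonneg {U : ℝ} (hU : 0 ≤ U) {δ : ℝ} (hδ0 : 0 < δ) (hδ1 : δ < 1) :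
    ∃ L₀ : ℕ, ∀ L : ℕ, L₀ ≤ L →
      groundEnergy (hubbardTorus 2 L 1 U) (2 * ⌊(1 - δ) * (L : ℝ) ^ 2 / 2⌋₊ + 1) +
          groundEnergy (hubbardTorus 2 L 1 U) (2 * ⌊(1 - δ) * (L : ℝ) ^ 2 / 2⌋₊ - 1) -
        2 * (hubbardTorus 2 L 1 U).minEnergyOn
          (szSector (Λ := FermionTorus 2 L) (2 * ⌊(1 - δ) * (L : ℝ) ^ 2 / 2⌋₊) 0) ≤
      4 + 12 / Real.sqrt δ := by
  have hx : 0 < 1 - δ := by linarith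
  refine ⟨⌈2 / (1 - δ)⌉₊ + 2, fun L hL => ?_⟩
  haveI : NeZero L := ⟨by omega⟩
  set n : ℕ := ⌊(1 - δ) * (L : ℝ) ^ 2 / 2⌋₊ with hn
  have hL1 : (1 : ℝ) ≤ L := by exact_mod_cast (show 1 ≤ L by omega)
  have hLr : (2 / (1 - δ) : ℝ) < L := by
    have h1 : (2 / (1 - δ) : ℝ) ≤ ⌈2 / (1 - δ)⌉₊ := Nat.le_ceil _
    have h2 : ((⌈2 / (1 - δ)⌉₊ : ℕ) : ℝ) + 2 ≤ L := by exact_mod_cast hL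
    linarith
  have hLpos : (0 : ℝ) < L := by linarith
  -- `1 ≤ n`
  have hn1 : 1 ≤ n := by
    have h1 : (1 - δ) * (L : ℝ) ^ 2 / 2 < (n : ℝ) + 1 := Nat.lt_floor_add_one _
    have h4 : 2 < (1 - δ) * L := by rw [div_lt_iff₀ hx] at hLr; linarith
    have h5 : (1 - δ) * L ≤ (1 - δ) * (L : ℝ) ^ 2 := by
      rw [sq]; exact mul_le_mul_of_nonneg_left (le_mul_of_one_le_left (by positivity) hL1) hx.le
    have : (0 : ℝ) < n := by linarith
    exact_mod_cast this
  -- `L² - 2n ≥ δ L²`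
  have h2n : (2 * n : ℝ) ≤ (1 - δ) * (L : ℝ) ^ 2 := by
    have h1 : (n : ℝ) ≤ (1 - δ) * (L : ℝ) ^ 2 / 2 := Nat.floor_le (by positivity)
    linarith
  have hgap : δ * (L : ℝ) ^ 2 ≤ (L : ℝ) ^ 2 - 2 * n := by linarith
  have hδL : 0 < δ * (L : ℝ) ^ 2 := by positivity
  have hlt : 2 * n < L ^ 2 := by
    have : (2 * n : ℝ) < (L : ℝ) ^ 2 := by nlinarith
    exact_mod_cast this
  have h := parityGap_le_of_nonneg (L := L) hU hn1 hlt
  -- `12 L / √(L² - 2n) ≤ 12 / √δ`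
  have hsδ : 0 < Real.sqrt δ := Real.sqrt_pos.2 hδ0
  have hmono : 12 * (L : ℝ) / Real.sqrt ((L : ℝ) ^ 2 - 2 * n) ≤ 12 / Real.sqrt δ := by
    have h1 : Real.sqrt (δ * (L : ℝ) ^ 2) ≤ Real.sqrt ((L : ℝ) ^ 2 - 2 * n) := Real.sqrt_le_sqrt hgap
    rw [Real.sqrt_mul hδ0.le, Real.sqrt_sq hLpos.le] at h1
    have h2 : 0 < Real.sqrt δ * L := by positivity
    calc 12 * (L : ℝ) / Real.sqrt ((L : ℝ) ^ 2 - 2 * n)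
        ≤ 12 * (L : ℝ) / (Real.sqrt δ * L) := div_le_div_of_nonneg_left (by positivity) h2 h1
      _ = 12 / Real.sqrt δ := by field_simp
  linarith

omit [NeZero L] in
/-- **A uniform parity gap of the repulsive model is at most `2 + 6/√δ`, whatever the coupling.**  If along
the even sides `L ≥ L₀` the Hubbard tori at doping `δ ∈ (0, 1)` and coupling `U ≥ 0` have parity gap `≥ 2Δ`
about the `(N_L, S^z = 0)` floor (the parity-gap clause (PG) of route `ParityGapRigidity`'s `GappedWindow`,
verbatim up to the name of the coupling), then `Δ ≤ 2 + 6/√δ`. [folklore] -/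
theorem uniformParityGap_le_of_nonneg {U : ℝ} (hU : 0 ≤ U) {δ : ℝ} (hδ0 : 0 < δ) (hδ1 : δ < 1)
    {Δ : ℝ} {L₀ : ℕ}
    (h : ∀ L ≥ L₀, Even L → ∀ Hm, Hm = hubbardTorus 2 L 1 U →
      2 * Δ ≤ groundEnergy Hm (2 * ⌊(1 - δ) * (L : ℝ) ^ 2 / 2⌋₊ + 1) +
        groundEnergy Hm (2 * ⌊(1 - δ) * (L : ℝ) ^ 2 / 2⌋₊ - 1) -
          2 * Matrix.minEnergyOn Hm (szSector (2 * ⌊(1 - δ) * (L : ℝ) ^ 2 / 2⌋₊) 0)) :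
    Δ ≤ 2 + 6 / Real.sqrt δ := by
  obtain ⟨L₁, hL₁⟩ := parityGap_le_of_doping_nonneg hU hδ0 hδ1
  set L : ℕ := 2 * (L₀ + L₁ + 1) with hLdef
  have hLe : Even L := ⟨L₀ + L₁ + 1, by rw [hLdef]; ring⟩
  have hlow := h L (by omega) hLe _ rfl
  have hup := hL₁ L (by omega)
  have h12 : (12 : ℝ) / Real.sqrt δ = 2 * (6 / Real.sqrt δ) := by ring
  linarith

omit [NeZero L] in
/-- **Both ceilings together**: a uniform parity gap of the repulsive Hubbard torus at doping
`δ ∈ (0, 1)` obeys `Δ ≤ min (2|U|/√(1-δ)) (2 + 6/√δ)` — `O(U)` at weak coupling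
(`uniformParityGap_le`), `O(t)` at strong coupling (`uniformParityGap_le_of_nonneg`). [folklore] -/
theorem uniformParityGap_le_min {U : ℝ} (hU : 0 ≤ U) {δ : ℝ} (hδ0 : 0 < δ) (hδ1 : δ < 1)
    {Δ : ℝ} {L₀ : ℕ}
    (h : ∀ L ≥ L₀, Even L → ∀ Hm, Hm = hubbardTorus 2 L 1 U →
      2 * Δ ≤ groundEnergy Hm (2 * ⌊(1 - δ) * (L : ℝ) ^ 2 / 2⌋₊ + 1) +
        groundEnergy Hm (2 * ⌊(1 - δ) * (L : ℝ) ^ 2 / 2⌋₊ - 1) -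
          2 * Matrix.minEnergyOn Hm (szSector (2 * ⌊(1 - δ) * (L : ℝ) ^ 2 / 2⌋₊) 0)) :
    Δ ≤ min (2 * |U| / Real.sqrt (1 - δ)) (2 + 6 / Real.sqrt δ) :=
  le_min (uniformParityGap_le U hδ0.le hδ1 h) (uniformParityGap_le_of_nonneg hU hδ0 hδ1 h)

end Ceiling

end Literature.MathematicalPhysics.QuantumLattice

end
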